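import Literature.NumberTheory.Rogawski1990.RankOneEulerPoincareGlue   -- ★ (R2-g) the glue on `U(H)(L⁺_v)`: `exists_isLocSmooth_classOrbitalIntegral_eq_one_zero_of_relations`
import HarnessLib

/-!
# [Kottwitz1988 §2; Rogawski1990 §12.6] (R2-g′) The Euler–Poincaré glue on `U₂ = U(Φ₂)(L⁺_v)` and the ASSEMBLY SKELETON of (R2)

Topic `NumberTheory/Rogawski1990`; namespace `Literature.NumberTheory.Rogawski1990`.  KERNEL LANE: theorems only (no `def`, no instance, no notation, no `sorry`, default
heartbeats).  Cell `pub/hodgecm-mathlib` (D-0151), crux H413 = stmt-HodgeConjecture-24833, line «N6nsGerm» residual `stub_N6nsR2EP : RankOneEulerPoincareNonsplit` (★ p841621),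
(R2) EP road; seat B-p14 (g31), brick (R2-g) part 2 (sibling of ★ `RankOneEulerPoincareGlue`).  HONEST LABEL: HC_CM is proved only modulo the printed citations until rung 0
closes; this file discharges NO count.

* `exists_isLocSmooth_classOrbitalIntegral_eq_one_zero_of_relations_two` — ★ `…_of_relations` at `H = Φ₂` (★ `antidiagOne_isHermitian`, ★ `isUnit_antidiagOne_det`): the body of
  ★ `RankOneEulerPoincareNonsplit` at `(L, v, ν, m)`, tokens verbatim, from three compact open subgroups `K, K′, I ≤ U₂` with (E) `#Fix_γ(U₂⧸K) + #Fix_γ(U₂⧸K′) = #Fix_γ(U₂⧸I) + 1`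
  at the elliptic regular `γ` and (N) `ν(K)⁻¹Φ(⟦γ⟧,𝟙_K) + ν(K′)⁻¹Φ(⟦γ⟧,𝟙_{K′}) − ν(I)⁻¹Φ(⟦γ⟧,𝟙_I) = 0` at the non-elliptic regular `γ`.
* **`rankOneEulerPoincareNonsplit_of_relations`** — THE ASSEMBLY SKELETON: `RankOneEulerPoincareNonsplit` follows from «at every `(L, v)` with one place of `L` over `v`, for every
  Haar `ν` and canonical `m`, `∃ K K′ I ≤ U₂` compact open with (E) ∧ (N)».  At an UNRAMIFIED non-split `v` the witnesses are the two vertex stabilisers `K = cmLocalIntegralLevel`,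
  `K′` (the `ϖ`-modular vertex) and the Iwahori `I = K ⊓ K′` of the `(q+1)`-regular tree of `U₂ ⊃ SU(1,1) ≅ SL₂(L⁺_v)` [Serre1980Trees, II.1.1], (E)∕(N) being the road's counts
  (★ L5 `V_K`, `V_{K′}`, `E`; the non-elliptic unfoldings); at a RAMIFIED `v` (one vertex orbit `K`, edge stabiliser `Ĩ` with inversion, orientation kernel `Ĩ⁺`) Kottwitz's
  `f_EP = ν(K)⁻¹𝟙_K − ν(Ĩ)⁻¹sgn·𝟙_Ĩ = ν(K)⁻¹𝟙_K + ν(Ĩ)⁻¹𝟙_Ĩ − ν(Ĩ⁺)⁻¹𝟙_{Ĩ⁺}` has the same three-term shape with `(K, K′, I) := (K, Ĩ, Ĩ⁺)`.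

## References
* [Kottwitz1988] R. E. Kottwitz, *Tamagawa numbers*, Ann. of Math. 127 (1988) 629–646: §2, Theorem 2.
* [Rogawski1990] J. D. Rogawski, *Automorphic Representations of Unitary Groups in Three Variables*, Ann. of Math. Stud. 123 (1990): §12.6 p. 174; §4.9 p. 54.
* [Serre1980Trees] J.-P. Serre, *Trees*, Springer (1980): II.1.1 (the tree of `SL₂` over a local field).
-/

noncomputable section

open NumberField IsDedekindDomain MeasureTheory Measure
open Literature.NumberTheory.Automorphic
open scoped Matrix MatrixGroups

namespace Literature.NumberTheory.Rogawski1990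

/-! ## §3 On `U₂ = U(Φ₂)(L⁺_v)`: the body of (R2) from the two relations, and the assembly skeleton -/

section RankOne

variable (L : Type) [Field L] [NumberField L] [IsCMField L] (v : HeightOneSpectrum (𝓞 ↥(maximalRealSubfield L)))
  [MeasurableSpace ((UnitaryGroup.cmDatum L 2 (Matrix.of fun i j : Fin 2 => if i.val + j.val + 1 = 2 then (1 : L) else 0)).Local v)]
  [BorelSpace ((UnitaryGroup.cmDatum L 2 (Matrix.of fun i j : Fin 2 => if i.val + j.val + 1 = 2 then (1 : L) else 0)).Local v)]
  [∀ γ : (UnitaryGroup.cmDatum L 2 (Matrix.of fun i j : Fin 2 => if i.val + j.val + 1 = 2 then (1 : L) else 0)).Local v,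
    MeasurableSpace (((UnitaryGroup.cmDatum L 2 (Matrix.of fun i j : Fin 2 => if i.val + j.val + 1 = 2 then (1 : L) else 0)).Local v) ⧸
      Subgroup.centralizer ({γ} : Set ((UnitaryGroup.cmDatum L 2 (Matrix.of fun i j : Fin 2 => if i.val + j.val + 1 = 2 then (1 : L) else 0)).Local v)))]
  [∀ γ : (UnitaryGroup.cmDatum L 2 (Matrix.of fun i j : Fin 2 => if i.val + j.val + 1 = 2 then (1 : L) else 0)).Local v,
    BorelSpace (((UnitaryGroup.cmDatum L 2 (Matrix.of fun i j : Fin 2 => if i.val + j.val + 1 = 2 then (1 : L) else 0)).Local v) ⧸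
      Subgroup.centralizer ({γ} : Set ((UnitaryGroup.cmDatum L 2 (Matrix.of fun i j : Fin 2 => if i.val + j.val + 1 = 2 then (1 : L) else 0)).Local v)))]
  (ν : Measure ((UnitaryGroup.cmDatum L 2 (Matrix.of fun i j : Fin 2 => if i.val + j.val + 1 = 2 then (1 : L) else 0)).Local v))
  [IsHaarMeasure ν] [ν.IsMulRightInvariant]

/-- **(R2-g) on `U₂`: the body of `RankOneEulerPoincareNonsplit` at `(L, v, ν, m)` from three compact open subgroups `K, K′, I ≤ U₂` satisfying (E) and (N)** (§2 with
`H = Φ₂`: ★ `antidiagOne_isHermitian`, ★ `isUnit_antidiagOne_det`).  At an unramified non-split `v`: `K` = the self-dual vertex stabiliser `cmLocalIntegralLevel`, `K′` = the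
`ϖ`-modular vertex stabiliser, `I = K ⊓ K′` the Iwahori. [cite: Kottwitz1988, §2 Theorem 2] [cite: Rogawski1990, §12.6 p. 174] [cite: Serre1980Trees, II.1.1] -/
theorem exists_isLocSmooth_classOrbitalIntegral_eq_one_zero_of_relations_two
    {m : OrbitalMeasureFamily ((UnitaryGroup.cmDatum L 2 (Matrix.of fun i j : Fin 2 => if i.val + j.val + 1 = 2 then (1 : L) else 0)).Local v)}
    (hm : m.IsCanonical (fun γ => IsRegularElt (γ.val : GL (Fin 2) (UnitaryGroup.LocalRing L v))) ν)
    (K K' I : Subgroup ((UnitaryGroup.cmDatum L 2 (Matrix.of fun i j : Fin 2 => if i.val + j.val + 1 = 2 then (1 : L) else 0)).Local v))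
    (hKo : IsOpen (K : Set ((UnitaryGroup.cmDatum L 2 (Matrix.of fun i j : Fin 2 => if i.val + j.val + 1 = 2 then (1 : L) else 0)).Local v)))
    (hKc : IsCompact (K : Set ((UnitaryGroup.cmDatum L 2 (Matrix.of fun i j : Fin 2 => if i.val + j.val + 1 = 2 then (1 : L) else 0)).Local v)))
    (hK'o : IsOpen (K' : Set ((UnitaryGroup.cmDatum L 2 (Matrix.of fun i j : Fin 2 => if i.val + j.val + 1 = 2 then (1 : L) else 0)).Local v)))
    (hK'c : IsCompact (K' : Set ((UnitaryGroup.cmDatum L 2 (Matrix.of fun i j : Fin 2 => if i.val + j.val + 1 = 2 then (1 : L) else 0)).Local v)))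
    (hIo : IsOpen (I : Set ((UnitaryGroup.cmDatum L 2 (Matrix.of fun i j : Fin 2 => if i.val + j.val + 1 = 2 then (1 : L) else 0)).Local v)))
    (hIc : IsCompact (I : Set ((UnitaryGroup.cmDatum L 2 (Matrix.of fun i j : Fin 2 => if i.val + j.val + 1 = 2 then (1 : L) else 0)).Local v)))
    (hE : ∀ γ : (UnitaryGroup.cmDatum L 2 (Matrix.of fun i j : Fin 2 => if i.val + j.val + 1 = 2 then (1 : L) else 0)).Local v,
      IsRegularElt (γ.val : GL (Fin 2) (UnitaryGroup.LocalRing L v)) →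
      CompactSpace (Subgroup.centralizer ({γ} : Set ((UnitaryGroup.cmDatum L 2 (Matrix.of fun i j : Fin 2 => if i.val + j.val + 1 = 2 then (1 : L) else 0)).Local v))) →
      Nat.card (MulAction.fixedBy ((UnitaryGroup.cmDatum L 2 (Matrix.of fun i j : Fin 2 => if i.val + j.val + 1 = 2 then (1 : L) else 0)).Local v ⧸ K) γ) +
        Nat.card (MulAction.fixedBy ((UnitaryGroup.cmDatum L 2 (Matrix.of fun i j : Fin 2 => if i.val + j.val + 1 = 2 then (1 : L) else 0)).Local v ⧸ K') γ) =
        Nat.card (MulAction.fixedBy ((UnitaryGroup.cmDatum L 2 (Matrix.of fun i j : Fin 2 => if i.val + j.val + 1 = 2 then (1 : L) else 0)).Local v ⧸ I) γ) + 1)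
    (hN : ∀ γ : (UnitaryGroup.cmDatum L 2 (Matrix.of fun i j : Fin 2 => if i.val + j.val + 1 = 2 then (1 : L) else 0)).Local v,
      IsRegularElt (γ.val : GL (Fin 2) (UnitaryGroup.LocalRing L v)) →
      ¬ CompactSpace (Subgroup.centralizer ({γ} : Set ((UnitaryGroup.cmDatum L 2 (Matrix.of fun i j : Fin 2 => if i.val + j.val + 1 = 2 then (1 : L) else 0)).Local v))) →
      (((ν K).toReal : ℂ))⁻¹ * classOrbitalIntegral m
          ((K : Set ((UnitaryGroup.cmDatum L 2 (Matrix.of fun i j : Fin 2 => if i.val + j.val + 1 = 2 then (1 : L) else 0)).Local v)).indicator fun _ => (1 : ℂ))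
          (ConjClasses.mk γ) +
        (((ν K').toReal : ℂ))⁻¹ * classOrbitalIntegral m
          ((K' : Set ((UnitaryGroup.cmDatum L 2 (Matrix.of fun i j : Fin 2 => if i.val + j.val + 1 = 2 then (1 : L) else 0)).Local v)).indicator fun _ => (1 : ℂ))
          (ConjClasses.mk γ) -
        (((ν I).toReal : ℂ))⁻¹ * classOrbitalIntegral m
          ((I : Set ((UnitaryGroup.cmDatum L 2 (Matrix.of fun i j : Fin 2 => if i.val + j.val + 1 = 2 then (1 : L) else 0)).Local v)).indicator fun _ => (1 : ℂ))
          (ConjClasses.mk γ) = 0) :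
    ∃ f : (UnitaryGroup.cmDatum L 2 (Matrix.of fun i j : Fin 2 => if i.val + j.val + 1 = 2 then (1 : L) else 0)).Local v → ℂ, IsLocSmooth f ∧
      (∀ γ : (UnitaryGroup.cmDatum L 2 (Matrix.of fun i j : Fin 2 => if i.val + j.val + 1 = 2 then (1 : L) else 0)).Local v,
          IsRegularElt (γ.val : GL (Fin 2) (UnitaryGroup.LocalRing L v)) →
          CompactSpace (Subgroup.centralizer ({γ} : Set ((UnitaryGroup.cmDatum L 2 (Matrix.of fun i j : Fin 2 => if i.val + j.val + 1 = 2 then (1 : L) else 0)).Local v))) →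
          classOrbitalIntegral m f (ConjClasses.mk γ) = 1) ∧
      (∀ γ : (UnitaryGroup.cmDatum L 2 (Matrix.of fun i j : Fin 2 => if i.val + j.val + 1 = 2 then (1 : L) else 0)).Local v,
          IsRegularElt (γ.val : GL (Fin 2) (UnitaryGroup.LocalRing L v)) →
          ¬ CompactSpace (Subgroup.centralizer ({γ} : Set ((UnitaryGroup.cmDatum L 2 (Matrix.of fun i j : Fin 2 => if i.val + j.val + 1 = 2 then (1 : L) else 0)).Local v))) →
          classOrbitalIntegral m f (ConjClasses.mk γ) = 0) :=
  exists_isLocSmooth_classOrbitalIntegral_eq_one_zero_of_relations L 2 _ v ν (UnitaryGroup.antidiagOne_isHermitian L 2) (UnitaryGroup.isUnit_antidiagOne_det L 2).ne_zero hm K K' I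
    hKo hKc hK'o hK'c hIo hIc hE hN

/-- **(R2) ASSEMBLY SKELETON: `RankOneEulerPoincareNonsplit` from the two relations at every non-split place.**  If at every `(L, v)` with one place of `L` over `v`, for
every Haar `ν` and every canonical `m`, there are compact open subgroups `K, K′, I ≤ U₂ = U(Φ₂)(L⁺_v)` satisfying (E) (elliptic fixed-point Euler characteristic `1`) and (N)
(non-elliptic weighted period sum `0`), then the letter (R2) holds — what the (R2) EP road's count bricks supply at the unramified `v` (with `K, K′` the two vertex stabilisers
and `I` the Iwahori of the tree) and a ramified dictionary must supply at the ramified `v`. [cite: Kottwitz1988, §2 Theorem 2] [cite: Rogawski1990, §12.6 p. 174] -/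
theorem rankOneEulerPoincareNonsplit_of_relations
    (h : ∀ (L : Type) [Field L] [NumberField L] [IsCMField L] (v : HeightOneSpectrum (𝓞 ↥(maximalRealSubfield L))),
      Subsingleton (UnitaryGroup.PlacesOver L v) →
      ∀ [MeasurableSpace ((UnitaryGroup.cmDatum L 2 (Matrix.of fun i j : Fin 2 => if i.val + j.val + 1 = 2 then (1 : L) else 0)).Local v)]
        [BorelSpace ((UnitaryGroup.cmDatum L 2 (Matrix.of fun i j : Fin 2 => if i.val + j.val + 1 = 2 then (1 : L) else 0)).Local v)]
        (ν : Measure ((UnitaryGroup.cmDatum L 2 (Matrix.of fun i j : Fin 2 => if i.val + j.val + 1 = 2 then (1 : L) else 0)).Local v))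
        [ν.IsHaarMeasure] [ν.IsMulRightInvariant]
        [_iZ : ∀ γ : (UnitaryGroup.cmDatum L 2 (Matrix.of fun i j : Fin 2 => if i.val + j.val + 1 = 2 then (1 : L) else 0)).Local v,
          MeasurableSpace (((UnitaryGroup.cmDatum L 2 (Matrix.of fun i j : Fin 2 => if i.val + j.val + 1 = 2 then (1 : L) else 0)).Local v) ⧸
            Subgroup.centralizer ({γ} : Set ((UnitaryGroup.cmDatum L 2 (Matrix.of fun i j : Fin 2 => if i.val + j.val + 1 = 2 then (1 : L) else 0)).Local v)))]
        [_bZ : ∀ γ : (UnitaryGroup.cmDatum L 2 (Matrix.of fun i j : Fin 2 => if i.val + j.val + 1 = 2 then (1 : L) else 0)).Local v,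
          BorelSpace (((UnitaryGroup.cmDatum L 2 (Matrix.of fun i j : Fin 2 => if i.val + j.val + 1 = 2 then (1 : L) else 0)).Local v) ⧸
            Subgroup.centralizer ({γ} : Set ((UnitaryGroup.cmDatum L 2 (Matrix.of fun i j : Fin 2 => if i.val + j.val + 1 = 2 then (1 : L) else 0)).Local v)))]
        (m : OrbitalMeasureFamily ((UnitaryGroup.cmDatum L 2 (Matrix.of fun i j : Fin 2 => if i.val + j.val + 1 = 2 then (1 : L) else 0)).Local v)),
        m.IsCanonical (fun γ => IsRegularElt (γ.val : GL (Fin 2) (UnitaryGroup.LocalRing L v))) ν →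
        ∃ K K' I : Subgroup ((UnitaryGroup.cmDatum L 2 (Matrix.of fun i j : Fin 2 => if i.val + j.val + 1 = 2 then (1 : L) else 0)).Local v),
          IsOpen (K : Set ((UnitaryGroup.cmDatum L 2 (Matrix.of fun i j : Fin 2 => if i.val + j.val + 1 = 2 then (1 : L) else 0)).Local v)) ∧
          IsCompact (K : Set ((UnitaryGroup.cmDatum L 2 (Matrix.of fun i j : Fin 2 => if i.val + j.val + 1 = 2 then (1 : L) else 0)).Local v)) ∧
          IsOpen (K' : Set ((UnitaryGroup.cmDatum L 2 (Matrix.of fun i j : Fin 2 => if i.val + j.val + 1 = 2 then (1 : L) else 0)).Local v)) ∧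
          IsCompact (K' : Set ((UnitaryGroup.cmDatum L 2 (Matrix.of fun i j : Fin 2 => if i.val + j.val + 1 = 2 then (1 : L) else 0)).Local v)) ∧
          IsOpen (I : Set ((UnitaryGroup.cmDatum L 2 (Matrix.of fun i j : Fin 2 => if i.val + j.val + 1 = 2 then (1 : L) else 0)).Local v)) ∧
          IsCompact (I : Set ((UnitaryGroup.cmDatum L 2 (Matrix.of fun i j : Fin 2 => if i.val + j.val + 1 = 2 then (1 : L) else 0)).Local v)) ∧
          (∀ γ : (UnitaryGroup.cmDatum L 2 (Matrix.of fun i j : Fin 2 => if i.val + j.val + 1 = 2 then (1 : L) else 0)).Local v,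
            IsRegularElt (γ.val : GL (Fin 2) (UnitaryGroup.LocalRing L v)) →
            CompactSpace (Subgroup.centralizer
              ({γ} : Set ((UnitaryGroup.cmDatum L 2 (Matrix.of fun i j : Fin 2 => if i.val + j.val + 1 = 2 then (1 : L) else 0)).Local v))) →
            Nat.card (MulAction.fixedBy ((UnitaryGroup.cmDatum L 2 (Matrix.of fun i j : Fin 2 => if i.val + j.val + 1 = 2 then (1 : L) else 0)).Local v ⧸ K) γ) +
              Nat.card (MulAction.fixedBy ((UnitaryGroup.cmDatum L 2 (Matrix.of fun i j : Fin 2 => if i.val + j.val + 1 = 2 then (1 : L) else 0)).Local v ⧸ K') γ) =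
              Nat.card (MulAction.fixedBy ((UnitaryGroup.cmDatum L 2 (Matrix.of fun i j : Fin 2 => if i.val + j.val + 1 = 2 then (1 : L) else 0)).Local v ⧸ I) γ) + 1) ∧
          (∀ γ : (UnitaryGroup.cmDatum L 2 (Matrix.of fun i j : Fin 2 => if i.val + j.val + 1 = 2 then (1 : L) else 0)).Local v,
            IsRegularElt (γ.val : GL (Fin 2) (UnitaryGroup.LocalRing L v)) →
            ¬ CompactSpace (Subgroup.centralizer
              ({γ} : Set ((UnitaryGroup.cmDatum L 2 (Matrix.of fun i j : Fin 2 => if i.val + j.val + 1 = 2 then (1 : L) else 0)).Local v))) →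
            (((ν K).toReal : ℂ))⁻¹ * classOrbitalIntegral m
                ((K : Set ((UnitaryGroup.cmDatum L 2 (Matrix.of fun i j : Fin 2 => if i.val + j.val + 1 = 2 then (1 : L) else 0)).Local v)).indicator fun _ => (1 : ℂ))
                (ConjClasses.mk γ) +
              (((ν K').toReal : ℂ))⁻¹ * classOrbitalIntegral m
                ((K' : Set ((UnitaryGroup.cmDatum L 2 (Matrix.of fun i j : Fin 2 => if i.val + j.val + 1 = 2 then (1 : L) else 0)).Local v)).indicator fun _ => (1 : ℂ))
                (ConjClasses.mk γ) -
              (((ν I).toReal : ℂ))⁻¹ * classOrbitalIntegral m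
                ((I : Set ((UnitaryGroup.cmDatum L 2 (Matrix.of fun i j : Fin 2 => if i.val + j.val + 1 = 2 then (1 : L) else 0)).Local v)).indicator fun _ => (1 : ℂ))
                (ConjClasses.mk γ) = 0)) :
    RankOneEulerPoincareNonsplit := by
  intro L _ _ _ v hsub _ _ ν _ _ _ _ m hm
  obtain ⟨K, K', I, hKo, hKc, hK'o, hK'c, hIo, hIc, hE, hN⟩ := h L v hsub ν m hm
  exact exists_isLocSmooth_classOrbitalIntegral_eq_one_zero_of_relations_two L v ν hm K K' I hKo hKc hK'o hK'c hIo hIc hE hN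

end RankOne

end Literature.NumberTheory.Rogawski1990

end
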